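import Summits.Ventures.HodgeRepro2.T5SU11KernelCompositionSharpDisc

/-!
# The Taylor series of the powers of the resolvent on `W_1` converges uniformly on `(0, ∞)`

Row 591 gave, for `g ∈ W_1` and `|μ − μ₂| < (λ₂ − 1)²`, the pointwise Taylor series
`(G^I_λ)^{n+1} g(t) = Σ_k (μ − μ₂)^k C(n+k, k) (G^I_{λ₂})^{n+k+1} g(t)`. Row 557's sharp bound
`|(G^I_{λ₂})^{n+k+1} g(t)| ≤ D Ξ(t)/((λ₂ − 1)²)^{n+k+1} ≤ D/((λ₂ − 1)²)^{n+k+1}` dominates the `k`-th term by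
`D/((λ₂ − 1)²)^{n+1} · C(k+n, n) q^k`, `q = |μ − μ₂|/(λ₂ − 1)² < 1`, and the Weierstrass M-test gives:

* `iterate_taylor_term_le` — the `t`-uniform term bound;
* `tendstoUniformlyOn_iterate_taylor` — **on the sharp disc the partial sums converge to `(G^I_λ)^{n+1} g` uniformly on
  `(0, ∞)`** (row 587 is the case `n = 0`);

Nothing is claimed about (N).

Blind lane: Mathlib + the HodgeRepro2 prefix only; no sorry; axioms ⊆ {propext, Classical.choice,
Quot.sound}.
-/

namespace Summit.Ventures.HodgeRepro2.T5SU11ResolventIterateTaylorUniform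

open Filter Topology MeasureTheory
open Set (Ioi Ioc)
open T5SU11Cartan T5SU11SphericalFunction T5SU11SphericalBounds T5SU11SphericalDecay T5SU11RadialGreenImproper
  T5SU11ResolventGroundStateWeight T5SU11WeightedSpaceGroundState T5SU11KernelCompositionSharpDisc

section measure

variable [MeasurableSpace Circle] [BorelSpace Circle]

variable {lam lam₂ : ℝ} (hlam : 1 < lam) (hlam₂ : 1 < lam₂)
  {g : ℝ → ℝ} (hg : ContinuousOn g (Ioi 0)) {D : ℝ} (hD : ∀ s, 0 < s → |g s| ≤ D * sph 1 (hyp s))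

include hlam₂ hg hD in
/-- **The `k`-th Taylor term of the powers, uniformly in `t > 0`**:
`|(μ − μ₂)^k C(n+k, k) (G^I_{λ₂})^{n+k+1} g(t)| ≤ D/((λ₂ − 1)²)^{n+1} · C(k+n, n) (|μ − μ₂|/(λ₂ − 1)²)^k`. -/
theorem iterate_taylor_term_le (n k : ℕ) {t : ℝ} (ht : 0 < t) :
    |(lam * (lam - 2) - lam₂ * (lam₂ - 2)) ^ k * (((n + k).choose k : ℝ)
        * ((greenSolI (fun t => sph lam₂ (hyp t)) (sphDecay lam₂))^[n + k + 1] g) t)|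
      ≤ D / ((lam₂ - 1) ^ 2) ^ (n + 1)
        * (((k + n).choose n : ℝ) * (|lam * (lam - 2) - lam₂ * (lam₂ - 2)| / (lam₂ - 1) ^ 2) ^ k) := by
  have hr : 0 < (lam₂ - 1) ^ 2 := by
    have : 0 < lam₂ - 1 := by linarith
    positivity
  have hD0 : 0 ≤ D := (class_of_le_mul_sph_one hlam₂ hD).2.1
  have hb := (iterate_mem_weighted_one hlam₂ hg hD (n + k + 1)).2 t ht
  have hΞt : sph 1 (hyp t) ≤ 1 := sph_hyp_le_one zero_le_one one_le_two t
  have hch : (n + k).choose k = (k + n).choose n := by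
    rw [add_comm n k, Nat.choose_symm_add]
  have hchpos : (0 : ℝ) ≤ ((n + k).choose k : ℝ) := Nat.cast_nonneg _
  rw [abs_mul, abs_mul, abs_pow, abs_of_nonneg hchpos]
  calc |lam * (lam - 2) - lam₂ * (lam₂ - 2)| ^ k * (((n + k).choose k : ℝ)
        * |((greenSolI (fun t => sph lam₂ (hyp t)) (sphDecay lam₂))^[n + k + 1] g) t|)
      ≤ |lam * (lam - 2) - lam₂ * (lam₂ - 2)| ^ k * (((n + k).choose k : ℝ)
        * (D * sph 1 (hyp t) / ((lam₂ - 1) ^ 2) ^ (n + k + 1))) := by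
        apply mul_le_mul_of_nonneg_left _ (pow_nonneg (abs_nonneg _) k)
        exact mul_le_mul_of_nonneg_left hb hchpos
    _ ≤ |lam * (lam - 2) - lam₂ * (lam₂ - 2)| ^ k * (((n + k).choose k : ℝ)
        * (D * 1 / ((lam₂ - 1) ^ 2) ^ (n + k + 1))) := by
        apply mul_le_mul_of_nonneg_left _ (pow_nonneg (abs_nonneg _) k)
        apply mul_le_mul_of_nonneg_left _ hchpos
        apply div_le_div_of_nonneg_right _ (pow_nonneg hr.le _)
        exact mul_le_mul_of_nonneg_left hΞt hD0
    _ = D / ((lam₂ - 1) ^ 2) ^ (n + 1)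
        * (((k + n).choose n : ℝ) * (|lam * (lam - 2) - lam₂ * (lam₂ - 2)| / (lam₂ - 1) ^ 2) ^ k) := by
        rw [hch, show n + k + 1 = (n + 1) + k by ring, pow_add, div_pow]
        field_simp

include hlam hlam₂ hg hD in
/-- **THE TAYLOR SERIES OF THE POWERS OF THE RESOLVENT CONVERGES UNIFORMLY ON `(0, ∞)`**: for `g ∈ W_1`,
`|μ − μ₂| < (λ₂ − 1)²` and every `n`, the partial sums `Σ_{k<N} (μ − μ₂)^k C(n+k, k) (G^I_{λ₂})^{n+k+1} g(t)` converge to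
`(G^I_λ)^{n+1} g(t)` uniformly in `t > 0` (Weierstrass M-test). -/
theorem tendstoUniformlyOn_iterate_taylor (hq : |lam * (lam - 2) - lam₂ * (lam₂ - 2)| < (lam₂ - 1) ^ 2) (n : ℕ) :
    TendstoUniformlyOn
      (fun N t => ∑ k ∈ Finset.range N, (lam * (lam - 2) - lam₂ * (lam₂ - 2)) ^ k * (((n + k).choose k : ℝ)
        * ((greenSolI (fun t => sph lam₂ (hyp t)) (sphDecay lam₂))^[n + k + 1] g) t))
      (fun t => ((greenSolI (fun t => sph lam (hyp t)) (sphDecay lam))^[n + 1] g) t) atTop (Ioi 0) := by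
  have hr : 0 < (lam₂ - 1) ^ 2 := by
    have : 0 < lam₂ - 1 := by linarith
    positivity
  have hq0 : 0 ≤ |lam * (lam - 2) - lam₂ * (lam₂ - 2)| / (lam₂ - 1) ^ 2 := div_nonneg (abs_nonneg _) hr.le
  have hq1 : |lam * (lam - 2) - lam₂ * (lam₂ - 2)| / (lam₂ - 1) ^ 2 < 1 := (div_lt_one hr).mpr hq
  have hnorm : ‖|lam * (lam - 2) - lam₂ * (lam₂ - 2)| / (lam₂ - 1) ^ 2‖ < 1 := by
    rw [Real.norm_eq_abs, abs_of_nonneg hq0]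
    exact hq1
  have hu : Summable (fun k : ℕ => D / ((lam₂ - 1) ^ 2) ^ (n + 1)
      * (((k + n).choose n : ℝ) * (|lam * (lam - 2) - lam₂ * (lam₂ - 2)| / (lam₂ - 1) ^ 2) ^ k)) :=
    (summable_choose_mul_geometric_of_norm_lt_one n hnorm).mul_left _
  refine (tendstoUniformlyOn_tsum_nat hu ?_).congr_right ?_
  · intro k t ht
    rw [Real.norm_eq_abs]
    exact iterate_taylor_term_le hlam₂ hg hD n k ht
  · intro t ht
    exact (iterate_hasSum hlam₂ hg hD hlam hq n ht).tsum_eq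

end measure

end Summit.Ventures.HodgeRepro2.T5SU11ResolventIterateTaylorUniform
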